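import Summits.AnomalousDissipation.AnomalousDissipation.Theorems.MomentParityPathField
import Summits.AnomalousDissipation.AnomalousDissipation.Theorems.MomentParityTimeAverages
import Summits.AnomalousDissipation.AnomalousDissipation.Theorems.StirringSphereEnsembleRealizationStubRestart
import Literature.Analysis.FluidPDE.StatisticalSolutionEnergyEq
import Literature.Analysis.FluidPDE.WeakSolution

/-!
# Crux `EnsembleRealization` (stmt-AnomalousDissipation-0215) — line `augmented-lift`,
# sub-stub M3 `stub_augEnergy` of stub `stub_augmentedLaw`: the energy inequality from
# almost every time

Supports stmt-AnomalousDissipation-0215 (stub `stub_augmentedLaw` of line `augmented-lift`,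
piece M3 of its reshape `stub_augCurrent` / `stub_augLimit` / `stub_augWeakForm` /
`stub_augEnergy`). Nothing here closes an item.

`stub_augEnergy`. Let `Q` be a finite law on a trajectory space `𝒦(R, L)` (`pathSpace`) whose
one-time coefficient marginals `law(ω̄(t, ·))`, `t ≥ 0`, are one fixed law (the coefficient law of
a measure `μ` on `H`). Then for `Q`-a.e. path `ω`, every family of `L²` fields `v t` with
`𝓕(v t) = ω̄(t)` and locally finite enstrophy which satisfies the energy inequality between
RATIONAL times, `E(v q') + ν ∫_q^{q'} ‖∇v‖² ≤ E(v q) + ∫_q^{q'} (f, v)`, satisfies it from almost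
every real time `s > 0` to every later time `t` (the form consumed by the landed `stub_restart`).

Proof: lower semicontinuity of `t ↦ pathEnergyTot ω t` along sequences (upper endpoint), Fatou
under the constant law of `pathEnergyTot ω s` for each fixed `s` plus Fubini (lower endpoint,
`ae_liminf_ofReal_pathEnergyTot_le`, `Measure.ae_ae_comm`), and a deterministic passage to the
limit along dyadic rationals (`energyIneq_of_good`).
-/

noncomputable section

set_option linter.dupNamespace false

open MeasureTheory Set Filter Topology Function Metric UnitAddTorus
open scoped BigOperators ENNReal InnerProductSpace RealInnerProductSpace

namespace Summit.AnomalousDissipation.AnomalousDissipation.Theorems.EnsembleRealization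

open Literature.Analysis.FunctionSpaces Literature.Analysis.FunctionSpaces.Torus
open Literature.Analysis.FluidPDE Literature.Analysis.FluidPDE.Torus
open Summit.AnomalousDissipation.AnomalousDissipation.Theorems.MomentParity

variable {ν : ℝ} {f : UnitAddTorus (Fin 3) → EuclideanSpace ℝ (Fin 3)}
  {μ : Measure (Torus.energySpace (Fin 3))}

/-! ### Lower semicontinuity of the total energy of a path along sequences of times -/

/-- **Lower semicontinuity of the path energy in time** (ε-form): along any sequence of times
`τ n → t`, eventually `pathEnergyTot ω t - ε ≤ pathEnergyTot ω (τ n)` (the total energy is the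
supremum of the truncated energies `pathEnergy (freqBall m)`, each continuous in time on `𝒦`). -/
theorem eventually_pathEnergyTot_sub_le {R : ℝ} {L : (Fin 3 → ℤ) → ℝ} {ω : Path (Fin 3)}
    (hω : ω ∈ pathSpace R L) (t : ℝ) {τ : ℕ → ℝ} (hτ : Tendsto τ atTop (𝓝 t)) {ε : ℝ}
    (hε : 0 < ε) : ∀ᶠ n in atTop, pathEnergyTot ω t - ε ≤ pathEnergyTot ω (τ n) := by
  -- a truncation capturing the energy at time `t` up to `ε / 2`
  have h1 : ∀ᶠ m : ℕ in atTop, pathEnergyTot ω t - ε / 2 < pathEnergy (freqBall m) ω t :=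
    (tendsto_order.1 (tendsto_pathEnergy_freqBall hω t)).1 (pathEnergyTot ω t - ε / 2) (by linarith)
  obtain ⟨m, hm⟩ := h1.exists
  -- the truncated energy is continuous in time
  have hc : Continuous fun s : ℝ => pathEnergy (freqBall m) ω s := by
    unfold pathEnergy
    exact continuous_finsetSum _ fun k _ => ((continuous_pathExt_time hω k).norm).pow 2
  have h2 : Tendsto (fun n => pathEnergy (freqBall m) ω (τ n)) atTop
      (𝓝 (pathEnergy (freqBall m) ω t)) := (hc.tendsto t).comp hτ
  filter_upwards [(tendsto_order.1 h2).1 _ hm] with n hn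
  linarith [pathEnergy_le_pathEnergyTot hω (freqBall m) (τ n)]

/-- **Lower semicontinuity of the path energy in time** (`liminf` form in `ℝ≥0∞`):
`ofReal (pathEnergyTot ω t) ≤ liminfₙ ofReal (pathEnergyTot ω (τ n))` whenever `τ n → t`. -/
theorem ofReal_pathEnergyTot_le_liminf {R : ℝ} {L : (Fin 3 → ℤ) → ℝ} {ω : Path (Fin 3)}
    (hω : ω ∈ pathSpace R L) (t : ℝ) {τ : ℕ → ℝ} (hτ : Tendsto τ atTop (𝓝 t)) :
    ENNReal.ofReal (pathEnergyTot ω t) ≤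
      liminf (fun n => ENNReal.ofReal (pathEnergyTot ω (τ n))) atTop := by
  refine ENNReal.le_of_forall_pos_le_add fun ε hε _ => ?_
  have h := eventually_pathEnergyTot_sub_le hω t hτ (ε := ε) (by exact_mod_cast hε)
  calc ENNReal.ofReal (pathEnergyTot ω t)
      = ENNReal.ofReal ((pathEnergyTot ω t - ε) + ε) := by rw [sub_add_cancel]
    _ ≤ ENNReal.ofReal (pathEnergyTot ω t - ε) + ENNReal.ofReal ε := ENNReal.ofReal_add_le
    _ ≤ liminf (fun n => ENNReal.ofReal (pathEnergyTot ω (τ n))) atTop + ε := by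
        rw [ENNReal.ofReal_coe_nnreal]
        exact add_le_add
          (le_liminf_of_le (by isBoundedDefault) (h.mono fun n hn => ENNReal.ofReal_le_ofReal hn)) le_rfl

/-! ### The constant law of the energy under the marginal identity, and Fatou -/

/-- **Transport of the energy through the marginal identity.** If the one-time coefficient
marginals of `Q` are the coefficient law of `μ`, then for every `t ≥ 0` the `ℝ≥0∞`-mean of the
total energy `∫⁻ ofReal (pathEnergyTot ω t) dQ` is one `t`-independent quantity (the mean of
`c ↦ ∑' ‖c k‖ₑ²` under the coefficient law). -/
theorem lintegral_ofReal_pathEnergyTot_eq {R : ℝ} {L : (Fin 3 → ℤ) → ℝ}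
    (Q : Measure ↥(pathSpace R L : Set (Path (Fin 3))))
    (hmarg : ∀ t, 0 ≤ t → Q.map (fun ω => fun k : Fin 3 → ℤ => pathExt ω.1 t k) =
      μ.map (fun u : Torus.energySpace (Fin 3) => fun k : Fin 3 → ℤ =>
        mFourierCoeff (EuclideanSpace.complexify ∘ (u.1 : UnitAddTorus (Fin 3) → EuclideanSpace ℝ (Fin 3))) k))
    {t : ℝ} (ht : 0 ≤ t) :
    ∫⁻ ω, ENNReal.ofReal (pathEnergyTot ω.1 t) ∂Q =
      ∫⁻ c, ∑' k, ‖c k‖ₑ ^ 2 ∂(μ.map (fun u : Torus.energySpace (Fin 3) => fun k : Fin 3 → ℤ =>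
        mFourierCoeff (EuclideanSpace.complexify ∘ (u.1 : UnitAddTorus (Fin 3) → EuclideanSpace ℝ (Fin 3))) k)) := by
  have hG : Measurable fun c : (Fin 3 → ℤ) → EuclideanSpace ℂ (Fin 3) => ∑' k, ‖c k‖ₑ ^ 2 :=
    Measurable.tsum fun k => (measurable_pi_apply k).enorm.pow_const 2
  have hF : Measurable fun ω : ↥(pathSpace R L : Set (Path (Fin 3))) => fun k : Fin 3 → ℤ =>
      pathExt ω.1 t k :=
    measurable_pi_lambda _ fun k => (continuous_pathExt_subtype R L t k).measurable
  rw [← hmarg t ht, lintegral_map hG hF]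
  refine lintegral_congr fun ω => ?_
  rw [pathEnergyTot, ENNReal.ofReal_tsum_of_nonneg (fun _ => sq_nonneg _)
    (summable_norm_pathExt_sq ω.2 t)]
  exact tsum_congr fun k => (enorm_sq_eq_ofReal_norm_sq _).symm

/-- The total energy at a fixed time is a measurable function on the trajectory space (in
`ℝ≥0∞` form). -/
theorem measurable_ofReal_pathEnergyTot (R : ℝ) (L : (Fin 3 → ℤ) → ℝ) (t : ℝ) :
    Measurable fun ω : ↥(pathSpace R L : Set (Path (Fin 3))) => ENNReal.ofReal (pathEnergyTot ω.1 t) :=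
  ((measurable_pathEnergyTot R L).comp (measurable_id.prodMk measurable_const)).ennreal_ofReal

/-- **Fatou under the stationary energy law.** If the one-time coefficient marginals of the finite
law `Q` are one fixed law, then for every `s ≥ 0` and every sequence of nonnegative times
`τ n → s`, `Q`-almost surely `liminfₙ ofReal (pathEnergyTot ω (τ n)) ≤ ofReal (pathEnergyTot ω s)`
(hence `=`, by lower semicontinuity): `∫ liminf ≤ liminf ∫ = ∫ ofReal (pathEnergyTot ω s)` and
the integrand dominates pointwise. -/
theorem ae_liminf_ofReal_pathEnergyTot_le {R : ℝ} {L : (Fin 3 → ℤ) → ℝ}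
    (Q : Measure ↥(pathSpace R L : Set (Path (Fin 3)))) [IsFiniteMeasure Q]
    (hmarg : ∀ t, 0 ≤ t → Q.map (fun ω => fun k : Fin 3 → ℤ => pathExt ω.1 t k) =
      μ.map (fun u : Torus.energySpace (Fin 3) => fun k : Fin 3 → ℤ =>
        mFourierCoeff (EuclideanSpace.complexify ∘ (u.1 : UnitAddTorus (Fin 3) → EuclideanSpace ℝ (Fin 3))) k))
    {s : ℝ} (hs : 0 ≤ s) {τ : ℕ → ℝ} (hτ0 : ∀ n, 0 ≤ τ n) (hτ : Tendsto τ atTop (𝓝 s)) :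
    ∀ᵐ ω ∂Q, liminf (fun n => ENNReal.ofReal (pathEnergyTot ω.1 (τ n))) atTop ≤
      ENNReal.ofReal (pathEnergyTot ω.1 s) := by
  have hgm := fun n => measurable_ofReal_pathEnergyTot R L (τ n)
  -- Fatou under the constant law (the integrand dominates pointwise by lower semicontinuity)
  have hconst : ∀ n, ∫⁻ ω, ENNReal.ofReal (pathEnergyTot ω.1 (τ n)) ∂Q =
      ∫⁻ ω, ENNReal.ofReal (pathEnergyTot ω.1 s) ∂Q := fun n => by
    rw [lintegral_ofReal_pathEnergyTot_eq Q hmarg (hτ0 n), lintegral_ofReal_pathEnergyTot_eq Q hmarg hs]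
  have hfatou : ∫⁻ ω, liminf (fun n => ENNReal.ofReal (pathEnergyTot ω.1 (τ n))) atTop ∂Q ≤
      ∫⁻ ω, ENNReal.ofReal (pathEnergyTot ω.1 s) ∂Q :=
    calc ∫⁻ ω, liminf (fun n => ENNReal.ofReal (pathEnergyTot ω.1 (τ n))) atTop ∂Q
        ≤ liminf (fun n => ∫⁻ ω, ENNReal.ofReal (pathEnergyTot ω.1 (τ n)) ∂Q) atTop :=
          lintegral_liminf_le hgm
      _ = ∫⁻ ω, ENNReal.ofReal (pathEnergyTot ω.1 s) ∂Q := by simp only [hconst, liminf_const]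
  have hfin : ∫⁻ ω, ENNReal.ofReal (pathEnergyTot ω.1 s) ∂Q ≠ ∞ := by
    refine ne_top_of_le_ne_top ?_ (lintegral_mono fun ω => ENNReal.ofReal_le_ofReal (pathEnergyTot_le ω.2 s))
    rw [lintegral_const]
    exact ENNReal.mul_ne_top ENNReal.ofReal_ne_top (measure_ne_top Q _)
  have heq : (fun ω : ↥(pathSpace R L : Set (Path (Fin 3))) => ENNReal.ofReal (pathEnergyTot ω.1 s)) =ᵐ[Q]
      fun ω => liminf (fun n => ENNReal.ofReal (pathEnergyTot ω.1 (τ n))) atTop :=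
    ae_eq_of_ae_le_of_lintegral_le (Eventually.of_forall fun ω => ofReal_pathEnergyTot_le_liminf ω.2 s hτ)
      hfin (Measurable.liminf hgm).aemeasurable hfatou
  filter_upwards [heq] with ω hω
  exact le_of_eq hω.symm

/-! ### Deterministic limit tools -/

/-- The dyadic approximations from below are monotone in the time, hence measurable. -/
theorem monotone_dyadicFloor (n : ℕ) : Monotone fun s : ℝ => (dyadicFloor s n : ℝ) := by
  intro s s' h
  simp only [dyadicFloor, Rat.cast_div, Rat.cast_intCast, Rat.cast_pow, Rat.cast_ofNat]
  refine div_le_div_of_nonneg_right ?_ (by positivity)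
  exact_mod_cast Int.floor_mono (mul_le_mul_of_nonneg_right (max_le_max h le_rfl) (by positivity))

/-- The upper dyadic approximations `⌊s⁺2ⁿ⌋/2ⁿ + 2⁻ⁿ` tend to `s⁺`. -/
theorem tendsto_dyadicFloor_add_inv (s : ℝ) :
    Tendsto (fun n : ℕ => (dyadicFloor s n : ℝ) + ((2 : ℝ) ^ n)⁻¹) atTop (𝓝 (max s 0)) := by
  simpa using (tendsto_dyadicFloor s).add tendsto_inv_two_pow

/-- **Exhaustion of an open interval**: if `a n → s` from the right of `s` and `b n → t` from the
left of `t`, then `∫⁻_{(a n, b n)} D → ∫⁻_{(s, t)} D` for every `D : ℝ → ℝ≥0∞` (no measurability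
or finiteness needed: inner exhaustion by `(s + 1/(m+1), t - 1/(m+1))` and monotonicity). -/
theorem tendsto_setLIntegral_Ioo (D : ℝ → ℝ≥0∞) {s t : ℝ} {a b : ℕ → ℝ}
    (ha : Tendsto a atTop (𝓝 s)) (hb : Tendsto b atTop (𝓝 t)) (hsa : ∀ n, s ≤ a n)
    (hbt : ∀ n, b n ≤ t) :
    Tendsto (fun n => ∫⁻ τ in Ioo (a n) (b n), D τ) atTop (𝓝 (∫⁻ τ in Ioo s t, D τ)) := by
  set c : ℕ → ℝ := fun m => 1 / ((m : ℝ) + 1) with hc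
  have hc0 : ∀ m, 0 < c m := fun m => by simp only [hc]; positivity
  have hmono : Monotone fun m => Ioo (s + c m) (t - c m) := by
    intro m m' h
    have : c m' ≤ c m := by
      simp only [hc]
      exact one_div_le_one_div_of_le (by positivity) (by exact_mod_cast Nat.add_le_add_right h 1)
    exact Ioo_subset_Ioo (by linarith) (by linarith)
  have hU : (⋃ m, Ioo (s + c m) (t - c m)) = Ioo s t := by
    apply Subset.antisymm
    · exact iUnion_subset fun m => Ioo_subset_Ioo (by linarith [hc0 m]) (by linarith [hc0 m])
    · intro τ hτ
      obtain ⟨m, hm⟩ := exists_nat_one_div_lt (lt_min (sub_pos.2 hτ.1) (sub_pos.2 hτ.2))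
      have h1 := hm.trans_le (min_le_left _ _)
      have h2 := hm.trans_le (min_le_right _ _)
      exact mem_iUnion.2 ⟨m, by simp only [hc]; linarith, by simp only [hc]; linarith⟩
  have hsup : ∫⁻ τ in Ioo s t, D τ = ⨆ m, ∫⁻ τ in Ioo (s + c m) (t - c m), D τ := by
    rw [← hU]
    exact setLIntegral_iUnion_of_directed D hmono.directed_le
  rw [tendsto_order]
  refine ⟨fun x hx => ?_, fun x hx => Eventually.of_forall fun n =>
    (lintegral_mono_set (Ioo_subset_Ioo (hsa n) (hbt n))).trans_lt hx⟩
  rw [hsup] at hx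
  obtain ⟨m, hm⟩ := lt_iSup_iff.1 hx
  have h1 : ∀ᶠ n in atTop, a n < s + c m := ha.eventually (eventually_lt_nhds (by linarith [hc0 m]))
  have h2 : ∀ᶠ n in atTop, t - c m < b n := hb.eventually (eventually_gt_nhds (by linarith [hc0 m]))
  filter_upwards [h1, h2] with n h1 h2
  exact hm.trans_le (lintegral_mono_set (Ioo_subset_Ioo h1.le h2.le))

/-- **Interval integrals of a bounded locally integrable function on `[0, ∞)` depend continuously
on the endpoints** (along sequences of nonnegative endpoints). -/
theorem tendsto_intervalIntegral_of_bound {W : ℝ → ℝ} {B : ℝ}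
    (hWi : ∀ a b, 0 ≤ a → 0 ≤ b → IntervalIntegrable W volume a b)
    (hWb : ∀ τ, 0 ≤ τ → |W τ| ≤ B) {s t : ℝ} (hs : 0 ≤ s) (ht : 0 ≤ t) {a b : ℕ → ℝ}
    (ha0 : ∀ n, 0 ≤ a n) (hb0 : ∀ n, 0 ≤ b n) (ha : Tendsto a atTop (𝓝 s))
    (hb : Tendsto b atTop (𝓝 t)) :
    Tendsto (fun n => ∫ τ in (a n)..(b n), W τ) atTop (𝓝 (∫ τ in s..t, W τ)) := by
  -- bound on a subinterval of `[0, ∞)`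
  have hbound : ∀ x y, 0 ≤ x → 0 ≤ y → |∫ τ in x..y, W τ| ≤ B * |y - x| := by
    intro x y hx hy
    have h := intervalIntegral.norm_integral_le_of_norm_le_const (a := x) (b := y) (C := B) (f := W)
      fun τ hτ => by
        rw [Real.norm_eq_abs]
        refine hWb τ ?_
        rcases mem_uIoc.1 hτ with h | h
        · exact hx.trans h.1.le
        · exact hy.trans h.1.le
    simpa only [Real.norm_eq_abs] using h
  have hdiff : ∀ n, |(∫ τ in (a n)..(b n), W τ) - ∫ τ in s..t, W τ| ≤ B * |s - a n| + B * |b n - t| := by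
    intro n
    have h1 : (∫ τ in (a n)..(b n), W τ) = (∫ τ in (a n)..s, W τ) + ∫ τ in s..(b n), W τ :=
      (intervalIntegral.integral_add_adjacent_intervals (hWi _ _ (ha0 n) hs) (hWi _ _ hs (hb0 n))).symm
    have h2 : (∫ τ in s..(b n), W τ) = (∫ τ in s..t, W τ) + ∫ τ in t..(b n), W τ :=
      (intervalIntegral.integral_add_adjacent_intervals (hWi _ _ hs ht) (hWi _ _ ht (hb0 n))).symm
    calc |(∫ τ in (a n)..(b n), W τ) - ∫ τ in s..t, W τ|
        = |(∫ τ in (a n)..s, W τ) + ∫ τ in t..(b n), W τ| := by rw [h1, h2]; ring_nf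
      _ ≤ |∫ τ in (a n)..s, W τ| + |∫ τ in t..(b n), W τ| := abs_add_le _ _
      _ ≤ B * |s - a n| + B * |b n - t| := add_le_add (hbound _ _ (ha0 n) hs) (hbound _ _ ht (hb0 n))
  have h0 : Tendsto (fun n => B * |s - a n| + B * |b n - t|) atTop (𝓝 0) := by
    have h1 : Tendsto (fun n => s - a n) atTop (𝓝 0) := by simpa using (tendsto_const_nhds (x := s)).sub ha
    simpa using (h1.abs.const_mul B).add ((show Tendsto (fun n => b n - t) atTop (𝓝 0) by
      simpa using hb.sub_const t).abs.const_mul B)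
  exact tendsto_sub_nhds_zero_iff.1
    (squeeze_zero_norm (fun n => by rw [Real.norm_eq_abs]; exact hdiff n) h0)

/-! ### The deterministic step: from rational times to a good real time -/

/-- **The energy inequality from a good time.** Along a path `ω ∈ 𝒦(R, L)`, let `v t ∈ L²` have
the coefficients `ω̄(t)`, locally finite enstrophy and the energy inequality between rational
times. If `0 < s < t` and `s` is a GOOD time, i.e. `liminfₙ ‖v(⌊s2ⁿ⌋/2ⁿ + 2⁻ⁿ)‖² ≤ ‖v s‖²`, then
the energy inequality holds from `s` to `t`: pass to the limit in the rational inequalities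
between `⌊s2ⁿ⌋/2ⁿ + 2⁻ⁿ ↓ s` and `⌊t2ⁿ⌋/2ⁿ ↑ t` (lower semicontinuity at `t`, the good-time
property at `s`, exhaustion for the dissipation, weak continuity for the work). -/
theorem energyIneq_of_good {R : ℝ} {L : (Fin 3 → ℤ) → ℝ} {ω : Path (Fin 3)} (hω : ω ∈ pathSpace R L)
    (hf : MemLp f 2 volume) {v : ℝ → UnitAddTorus (Fin 3) → EuclideanSpace ℝ (Fin 3)}
    (hcoef : ∀ t, 0 ≤ t → MemLp (v t) 2 volume ∧
      ∀ k, mFourierCoeff (EuclideanSpace.complexify ∘ v t) k = pathExt ω t k)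
    (hens : ∀ T, 0 < T → ∫⁻ t in Ioo 0 T, eGradNormSq (v t) < ∞)
    (hS : ∀ q q' : ℚ, 0 ≤ q → q ≤ q' →
      kineticEnergy (v q') + ν * (∫⁻ τ in Ioo (q : ℝ) q', eGradNormSq (v τ)).toReal ≤
        kineticEnergy (v q) + ∫ τ in (q : ℝ)..q', ∫ x, ⟪f x, v τ x⟫_ℝ)
    {s t : ℝ} (hs : 0 < s) (hst : s < t)
    (hgood : liminf (fun n : ℕ => ENNReal.ofReal
        (pathEnergyTot ω ((dyadicFloor s n : ℝ) + ((2 : ℝ) ^ n)⁻¹))) atTop ≤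
      ENNReal.ofReal (pathEnergyTot ω s)) :
    kineticEnergy (v t) + ν * (∫⁻ τ in Ioo s t, eGradNormSq (v τ)).toReal ≤
      kineticEnergy (v s) + ∫ τ in s..t, ∫ x, ⟪f x, v τ x⟫_ℝ := by
  have ht0 : 0 < t := hs.trans hst
  -- the two sequences of rational times
  have ha_gt : ∀ n : ℕ, s < (dyadicFloor s n : ℝ) + ((2 : ℝ) ^ n)⁻¹ := fun n => by
    simpa only [max_eq_left hs.le] using lt_dyadicFloor_add s n
  have ha0 : ∀ n : ℕ, 0 ≤ (dyadicFloor s n : ℝ) + ((2 : ℝ) ^ n)⁻¹ := fun n => hs.le.trans (ha_gt n).le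
  have hb_le : ∀ n : ℕ, (dyadicFloor t n : ℝ) ≤ t := fun n => le_of_le_of_eq (dyadicFloor_le t n) (max_eq_left ht0.le)
  have hb0 : ∀ n : ℕ, 0 ≤ (dyadicFloor t n : ℝ) := fun n => by exact_mod_cast dyadicFloor_nonneg t n
  have ha_t : Tendsto (fun n : ℕ => (dyadicFloor s n : ℝ) + ((2 : ℝ) ^ n)⁻¹) atTop (𝓝 s) := by
    simpa only [max_eq_left hs.le] using tendsto_dyadicFloor_add_inv s
  have hb_t : Tendsto (fun n : ℕ => (dyadicFloor t n : ℝ)) atTop (𝓝 t) := by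
    simpa only [max_eq_left ht0.le] using tendsto_dyadicFloor t
  -- kinetic energy of the path field
  have hKE : ∀ τ, 0 ≤ τ → kineticEnergy (v τ) = 2⁻¹ * pathEnergyTot ω τ := fun τ hτ => by
    rw [kineticEnergy, integral_norm_sq_eq_pathEnergyTot (hcoef τ hτ).1 (hcoef τ hτ).2]
  -- the dissipation: finite on `(s, t)`, limit of the dissipations on the approximating intervals
  have hXfin : ∫⁻ τ in Ioo s t, eGradNormSq (v τ) ≠ ∞ :=
    ne_top_of_le_ne_top (hens t ht0).ne (lintegral_mono_set (Ioo_subset_Ioo_left hs.le))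
  have hXn : Tendsto (fun n : ℕ => ν * (∫⁻ τ in Ioo ((dyadicFloor s n : ℝ) + ((2 : ℝ) ^ n)⁻¹)
      (dyadicFloor t n : ℝ), eGradNormSq (v τ)).toReal) atTop
      (𝓝 (ν * (∫⁻ τ in Ioo s t, eGradNormSq (v τ)).toReal)) :=
    ((ENNReal.tendsto_toReal hXfin).comp (tendsto_setLIntegral_Ioo (fun τ => eGradNormSq (v τ))
      ha_t hb_t (fun n => (ha_gt n).le) hb_le)).const_mul ν
  -- the work: continuous and bounded on `[0, ∞)`
  have hv0 : ∀ t, 0 ≤ t → MemLp (v t) 2 volume ∧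
      ∀ k, mFourierCoeff (EuclideanSpace.complexify ∘ v t) k = pathExt ω (0 + t) k := fun t ht =>
    ⟨(hcoef t ht).1, fun k => by rw [zero_add]; exact (hcoef t ht).2 k⟩
  have hWc : ContinuousOn (fun τ : ℝ => ∫ x, ⟪f x, v τ x⟫_ℝ) (Ici 0) := by
    refine (continuousOn_integral_inner_pathField hω hv0 hf).congr fun τ _ => ?_
    exact integral_congr_ae (ae_of_all _ fun x => real_inner_comm _ _)
  have hWi : ∀ a b : ℝ, 0 ≤ a → 0 ≤ b →
      IntervalIntegrable (fun τ : ℝ => ∫ x, ⟪f x, v τ x⟫_ℝ) volume a b := fun a b ha hb => by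
    refine (hWc.mono fun x hx => ?_).intervalIntegrable
    rcases mem_uIcc.1 hx with h | h
    exacts [ha.trans h.1, hb.trans h.1]
  have hWb : ∀ τ, 0 ≤ τ → |∫ x, ⟪f x, v τ x⟫_ℝ| ≤ Real.sqrt (∫ x, ‖f x‖ ^ 2) * Real.sqrt (R ^ 2) :=
    fun τ hτ => (abs_integral_inner_le_of_coef (hcoef τ hτ).1 (hcoef τ hτ).2 hf).trans
      (mul_le_mul_of_nonneg_left (Real.sqrt_le_sqrt (pathEnergyTot_le hω τ)) (Real.sqrt_nonneg _))
  have hWt : Tendsto (fun n : ℕ => ∫ τ in ((dyadicFloor s n : ℝ) + ((2 : ℝ) ^ n)⁻¹)..(dyadicFloor t n : ℝ),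
      ∫ x, ⟪f x, v τ x⟫_ℝ) atTop (𝓝 (∫ τ in s..t, ∫ x, ⟪f x, v τ x⟫_ℝ)) :=
    tendsto_intervalIntegral_of_bound hWi hWb hs.le ht0.le ha0 hb0 ha_t hb_t
  -- the `ε`-argument
  refine le_of_forall_pos_le_add fun ε hε => ?_
  have hε3 : 0 < ε / 3 := by positivity
  have e1 : ∀ᶠ n : ℕ in atTop, pathEnergyTot ω t - ε / 3 ≤ pathEnergyTot ω (dyadicFloor t n : ℝ) :=
    eventually_pathEnergyTot_sub_le hω t hb_t hε3
  have e2 := Metric.tendsto_nhds.1 hXn _ hε3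
  have e3 := Metric.tendsto_nhds.1 hWt _ hε3
  have e4 : ∀ᶠ n : ℕ in atTop, (dyadicFloor s n : ℝ) + ((2 : ℝ) ^ n)⁻¹ ≤ (dyadicFloor t n : ℝ) := by
    have h1 : ∀ᶠ n : ℕ in atTop, (dyadicFloor s n : ℝ) + ((2 : ℝ) ^ n)⁻¹ < (s + t) / 2 :=
      ha_t.eventually (eventually_lt_nhds (by linarith))
    have h2 : ∀ᶠ n : ℕ in atTop, (s + t) / 2 < (dyadicFloor t n : ℝ) :=
      hb_t.eventually (eventually_gt_nhds (by linarith))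
    filter_upwards [h1, h2] with n h1 h2 using by linarith
  have hE0 : 0 ≤ pathEnergyTot ω s := pathEnergyTot_nonneg ω s
  have fr : ∃ᶠ n : ℕ in atTop, pathEnergyTot ω ((dyadicFloor s n : ℝ) + ((2 : ℝ) ^ n)⁻¹) <
      pathEnergyTot ω s + ε / 3 := by
    have h1 : liminf (fun n : ℕ => ENNReal.ofReal
        (pathEnergyTot ω ((dyadicFloor s n : ℝ) + ((2 : ℝ) ^ n)⁻¹))) atTop <
        ENNReal.ofReal (pathEnergyTot ω s + ε / 3) :=
      hgood.trans_lt ((ENNReal.ofReal_lt_ofReal_iff (by linarith)).2 (by linarith))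
    exact (frequently_lt_of_liminf_lt (by isBoundedDefault) h1).mono fun n hn =>
      (ENNReal.ofReal_lt_ofReal_iff (by linarith)).1 hn
  obtain ⟨n, hn0, ⟨hn1, hn2⟩, hn3, hn4⟩ := (fr.and_eventually ((e1.and e2).and (e3.and e4))).exists
  -- the rational inequality between the two approximants
  have hcast : ((dyadicFloor s n + ((2 : ℚ) ^ n)⁻¹ : ℚ) : ℝ) =
      (dyadicFloor s n : ℝ) + ((2 : ℝ) ^ n)⁻¹ := by
    push_cast
    ring
  have hq0 : (0 : ℚ) ≤ dyadicFloor s n + ((2 : ℚ) ^ n)⁻¹ := by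
    have h := ha0 n
    rw [← hcast] at h
    exact_mod_cast h
  have hqq : dyadicFloor s n + ((2 : ℚ) ^ n)⁻¹ ≤ dyadicFloor t n := by
    have h := hn4
    rw [← hcast] at h
    exact_mod_cast h
  have hSn := hS _ _ hq0 hqq
  rw [hcast, hKE _ (ha0 n), hKE _ (hb0 n)] at hSn
  rw [hKE t ht0.le, hKE s hs.le]
  rw [Real.dist_eq] at hn2 hn3
  obtain ⟨h2, h2'⟩ := abs_lt.1 hn2
  obtain ⟨h3, h3'⟩ := abs_lt.1 hn3
  linarith

/-! ### The sub-stub -/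

/-- **Sub-stub M3 of `stub_augmentedLaw` (energy inequality from almost every time).** Let `Q`
be a finite law on a trajectory space `𝒦(R, L)` whose one-time coefficient marginals at all times
`t ≥ 0` are one fixed law (the coefficient law of `μ`). Then for `Q`-a.e. path `ω` and every
family of `L²` fields `v t` with `𝓕(v t) = ω̄(t)` and locally finite enstrophy, the energy
inequality between RATIONAL times `E(v q') + ν∫_q^{q'}‖∇v‖² ≤ E(v q) + ∫_q^{q'}(f, v)` implies
the energy inequality from almost every real time `s > 0` to every `t ≥ s`. Proof: lower
semicontinuity of `t ↦ pathEnergyTot ω t` at the upper endpoint; at the lower endpoint Fatou's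
lemma under the constant law of `pathEnergyTot ω s` (`ae_liminf_ofReal_pathEnergyTot_le`) for
each fixed `s`, then Fubini (`Measure.ae_ae_comm`, the good set is jointly measurable); the
deterministic passage to the limit is `energyIneq_of_good`. [FoiasRosaTemam2019 §2.1;
RobinsonRodrigoSadowski2016 Thm 4.6] -/
theorem stub_augEnergy (hf : MemLp f 2 volume) {R : ℝ} {L : (Fin 3 → ℤ) → ℝ}
    (Q : Measure ↥(pathSpace R L : Set (Path (Fin 3)))) [IsFiniteMeasure Q]
    (hmarg : ∀ t, 0 ≤ t → Q.map (fun ω => fun k : Fin 3 → ℤ => pathExt ω.1 t k) =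
      μ.map (fun u : Torus.energySpace (Fin 3) => fun k : Fin 3 → ℤ =>
        mFourierCoeff (EuclideanSpace.complexify ∘ (u.1 : UnitAddTorus (Fin 3) → EuclideanSpace ℝ (Fin 3))) k)) :
    ∀ᵐ ω ∂Q, ∀ v : ℝ → UnitAddTorus (Fin 3) → EuclideanSpace ℝ (Fin 3),
      (∀ t, 0 ≤ t → MemLp (v t) 2 volume ∧
        ∀ k, mFourierCoeff (EuclideanSpace.complexify ∘ v t) k = pathExt ω.1 t k) →
      (∀ T, 0 < T → ∫⁻ t in Ioo 0 T, eGradNormSq (v t) < ∞) →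
      (∀ q q' : ℚ, 0 ≤ q → q ≤ q' →
        kineticEnergy (v q') + ν * (∫⁻ τ in Ioo (q : ℝ) q', eGradNormSq (v τ)).toReal ≤
          kineticEnergy (v q) + ∫ τ in (q : ℝ)..q', ∫ x, ⟪f x, v τ x⟫_ℝ) →
      ∀ᵐ s ∂(volume.restrict (Ioi (0 : ℝ))), ∀ t, s ≤ t →
        kineticEnergy (v t) + ν * (∫⁻ τ in Ioo s t, eGradNormSq (v τ)).toReal ≤
          kineticEnergy (v s) + ∫ τ in s..t, ∫ x, ⟪f x, v τ x⟫_ℝ := by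
  -- Step 1: every fixed time `s ≥ 0` is good for a.e. path
  have hstep : ∀ s : ℝ, 0 ≤ s → ∀ᵐ ω ∂Q, liminf (fun n : ℕ => ENNReal.ofReal
      (pathEnergyTot ω.1 ((dyadicFloor s n : ℝ) + ((2 : ℝ) ^ n)⁻¹))) atTop ≤
      ENNReal.ofReal (pathEnergyTot ω.1 s) := fun s hs =>
    ae_liminf_ofReal_pathEnergyTot_le Q hmarg hs
      (fun n => le_of_lt ((le_max_right s 0).trans_lt (lt_dyadicFloor_add s n)))
      (by simpa only [max_eq_left hs] using tendsto_dyadicFloor_add_inv s)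
  -- Step 2: Fubini — a.e. path is good at a.e. time
  have hmeasS : MeasurableSet {p : ↥(pathSpace R L : Set (Path (Fin 3))) × ℝ |
      liminf (fun n : ℕ => ENNReal.ofReal
        (pathEnergyTot p.1.1 ((dyadicFloor p.2 n : ℝ) + ((2 : ℝ) ^ n)⁻¹))) atTop ≤
      ENNReal.ofReal (pathEnergyTot p.1.1 p.2)} := by
    refine measurableSet_le (Measurable.liminf fun n => ?_) (measurable_pathEnergyTot R L).ennreal_ofReal
    exact ((measurable_pathEnergyTot R L).comp (measurable_fst.prodMk
      (((monotone_dyadicFloor n).measurable.add_const _).comp measurable_snd))).ennreal_ofReal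
  have hae : ∀ᵐ ω ∂Q, ∀ᵐ s ∂(volume.restrict (Ioi (0 : ℝ))),
      liminf (fun n : ℕ => ENNReal.ofReal
        (pathEnergyTot ω.1 ((dyadicFloor s n : ℝ) + ((2 : ℝ) ^ n)⁻¹))) atTop ≤
      ENNReal.ofReal (pathEnergyTot ω.1 s) := by
    rw [Measure.ae_ae_comm hmeasS]
    filter_upwards [ae_restrict_mem (measurableSet_Ioi (a := (0 : ℝ)))] with s hs
    exact hstep s (le_of_lt hs)
  -- Step 3: the deterministic passage to the limit
  filter_upwards [hae] with ω hω v hcoef hens hS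
  filter_upwards [hω, ae_restrict_mem (measurableSet_Ioi (a := (0 : ℝ)))] with s hs hs0 t hst
  rcases eq_or_lt_of_le hst with rfl | hst'
  · simp
  · exact energyIneq_of_good ω.2 hf hcoef hens hS hs0 hst' hs

end Summit.AnomalousDissipation.AnomalousDissipation.Theorems.EnsembleRealization
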